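import Summits.BirchSwinnertonDyer.BirchSwinnertonDyer.Theorems.ByReductionTypeAtTwoSupersingularFlatRoadDoor
import Summits.BirchSwinnertonDyer.BirchSwinnertonDyer.Theorems.ByReductionTypeAtTwoSupersingularColemanClassKit
import HarnessLib

/-!
# Route `ByReductionTypeAtTwo` (rung K4), crux `SupersingularRankZeroAtTwo` (item
# stmt-BirchSwinnertonDyer-19097): CLASS-INSTANCE KIT for the `a₂ = ±2` sub-row on the ♭ Coleman road —
# the door on INTEGER models with every side condition in decidable / certificate form, so that a class
# file = this theorem applied to literals + `decide`s (seat `bsd-2adic-ss-1`, GEN 9; generator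
# HOME/ss/classes/gen_flat.py; the `a₂ = 0` twin is `…SupersingularColemanClassKit.lean`, p490756)

HONEST FRAMING (cell `bsd-2adic`, run/shared/lean/pub/bsd-2adic/, HUMAN RULINGS D-0036/D-0054/D-0074):
THEOREMS ONLY; no definition, no named fact, no instance, no `sorry`; nothing booked; BSD is NOT proved by
any of this. PARTITION (D-0054): X5@2 good-supersingular, `a₂ = ±2` sub-row (B1·O1; 549 rank-`0` classes)
× `p = 2` — types-the-object-of (item 19097 AT each class); closes none.

## Contents

* `goodSS_two_baseChange_int_of_card` — `2 ∤ Δ(M)` and `#M̃(𝔽₂) = k ∈ {1, 5}` ⇒ good SUPERSINGULAR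
  reduction at `2` with `a₂ = 3 − k = ±2` (Silverman VII.5 Prop. 5.1 (a); `a₂ = 3 − #Ẽ(𝔽₂)`).
* `bsdp_two_baseChange_int_of_flatColemanKato` — **the one-line target of a class file** (image-certificate
  branch): KERNEL inputs decided per class on literals (`Δ, c₄, b₂, b₄, b₆`, `2 ∤ Δ`, `#M̃(𝔽₂) ∈ {1,5}`,
  `c₄³/Δ = n/d`, four Dokchitser–Dokchitser certificates `ℓ₁…ℓ₄` for `TwoAdicSurjective`, `2^(m+1) ∤ Q`);
  DISPLAYED: PRINT {`hmod`, `hGZK`, `h124`, `hX0`, `hDD`}; for ARBITRARY supplied local Coleman data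
  `(κ, γ, ι, g, c)` the READ-AT-2 binders {EC♭ = Sprung 2024 L5.5·5.8·5.9 @2, CK♭ = the ♭ package @2
  (F1♭ · F3♭ · F4rat · F4@(2) guarded)} of `SSFlatRoad.bsdp_two_of_flatColemanKato_of_pow_dvd`; CERT
  {`L(E,1) ≠ 0`, `#Ш_an = Q`, `2^m ∣ #Ш`}. Conclusion `BSDp W 2`.
* `bsdp_two_baseChange_int_of_flatUpper` — the same WITHOUT the image certificate: the READ-AT-2 binder is
  the ♭ upper divisibility at the curve itself (`hup`, conclusion of `flatUpper_two_of_flatColemanKato_of_mu`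
  on a non-surjective curve, i.e. the package's rational part + `μ(X^♭) = 0`).
The data `(κ, γ, ι, g, c)` are universally quantified: a class theorem says that ANY local Coleman data for
which Sprung's ♭ theory holds at `2` (in print: his Honda system at `2`, Thm. 2.2 (2′), with the Coleman
maps of §§2–6 at `p = 2`) yield `BSD(E,2)` — no Honda predicate at `2` is asserted in the tree.

References: [Sprung2012] Thm. 2.2, §§2–6, Thm. 7.14, 7.16, Prop. 7.19; [Sprung2024] §5.2 Lemmas 5.5–5.9;
[Sprung2017] Cor. 4.11; [Kato2004Asterisque] Thm. 12.4–12.5; [KuriharaOtsuki2006] p. 564;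
[DokchitserDokchitserMathZ2012] Theorem; [SilvermanAEC2009] VII.5 Prop. 5.1, App. C §11; [Miller2011LMS] Def. 1.1.
-/

set_option autoImplicit false
-- the Theorems namespace of this sub repeats the summit name by design (D-0017 nested layout)
set_option linter.dupNamespace false

noncomputable section

open scoped Classical MatrixGroups ModularForm
open CongruenceSubgroup WeierstrassCurve Literature.NumberTheory.EllipticCurves
  Literature.NumberTheory.EllipticCurves.ModularForms Literature.NumberTheory.EllipticCurves.Sprung2017
  Literature.NumberTheory.EllipticCurves.Sprung2012
  Literature.NumberTheory.EllipticCurves.Rank1Residual Literature.NumberTheory.EllipticCurves.Rank1Residual.Typed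
  Literature.NumberTheory.EllipticCurves.IwasawaDual Literature.NumberTheory.GaloisRepresentations
  ZpExtension Summit.BirchSwinnertonDyer.Rank1Residual Summit.BirchSwinnertonDyer.Rank1Residual.Supersingular
  Summit.BirchSwinnertonDyer.Rank1Residual.X5 Summit.BirchSwinnertonDyer.Rank1Residual.X5.O1
  Summit.BirchSwinnertonDyer.Rank1Residual.X5.Instances

namespace Summit.BirchSwinnertonDyer.BirchSwinnertonDyer.Theorems
namespace SSFlatRoad

/-! ## §1 Integer-model bookkeeping for the `a₂ = ±2` classes -/

section IntModel

variable (M : WeierstrassCurve ℤ)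

/-- **Good supersingular reduction at `2` with `a₂(E) = ±2`, read off the integer model**: for a globally
minimal `M ⊗ ℚ`, `2 ∤ Δ(M)` gives good reduction at `2` (Silverman VII.5 Prop. 5.1 (a)) and
`#M̃(𝔽₂) = k ∈ {1, 5}` gives `a₂ = 3 − k ∈ {2, −2}`, even, hence `GoodSS`.
[cite: SilvermanAEC2009, VII.5 Prop. 5.1(a) and V.2] -/
theorem goodSS_two_baseChange_int_of_card [(M.baseChange ℚ).IsGloballyMinimal]
    (hΔ : ¬ (2 : ℤ) ∣ M.Δ) {k : ℕ} (hcard : Nat.card (M.map (Int.castRingHom (ZMod 2))).toAffine.Point = k)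
    (hk : k = 1 ∨ k = 5) :
    (M.baseChange ℚ).HasGoodReductionAtPrime 2 ∧
      ((M.baseChange ℚ).frobeniusTrace 2 = 2 ∨ (M.baseChange ℚ).frobeniusTrace 2 = -2) ∧
      GoodSS (M.baseChange ℚ) 2 := by
  have hgood : (M.baseChange ℚ).HasGoodReductionAtPrime 2 :=
    hasGoodReductionAtPrime_of_not_dvd _ 2 (by
      rw [Instances.minimalDiscriminantInt_baseChange_int]; exact_mod_cast hΔ)
  have ha : (M.baseChange ℚ).frobeniusTrace 2 = 3 - (k : ℤ) := frobeniusTrace_two_baseChange_int M hcard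
  rcases hk with rfl | rfl
  · have h2 : (M.baseChange ℚ).frobeniusTrace 2 = 2 := by rw [ha]; norm_num
    exact ⟨hgood, Or.inl h2, hgood, by rw [h2]; norm_num⟩
  · have h2 : (M.baseChange ℚ).frobeniusTrace 2 = -2 := by rw [ha]; norm_num
    exact ⟨hgood, Or.inr h2, hgood, by rw [h2]; norm_num⟩

end IntModel

/-! ## §2 The one-line targets of a class file -/

/-- **`BSD(E, 2)` for `E = M ⊗ ℚ` ON THE ♭ COLEMAN ROAD — the class-instance shape of crux
`SupersingularRankZeroAtTwo` on the `a₂ = ±2`, `2`-adically surjective classes.** KERNEL inputs (decided per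
class on literals): `Δ(M) = D` odd, `c₄(M) = C4`, `b₂, b₄, b₆`, `#M̃(𝔽₂) = k ∈ {1, 5}` (`a₂ = ±2`),
`C4³/D = n/d`, four Dokchitser–Dokchitser certificates `ℓ₁…ℓ₄`, `2^(m+1) ∤ Q`; the instances `IsElliptic`,
`IsGloballyMinimal` of `W = M ⊗ ℚ` (class file). DISPLAYED: PRINT {`hmod`, `hGZK`, `h124`, `hX0`, `hDD`};
READ-AT-2, for ARBITRARY supplied `(κ, γ, ι, g, c)`: {`hEC` = the ♭ `Γ`-Euler characteristic at `2`, `hCK` =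
the ♭ package at `2`}; CERT {`L(E,1) ≠ 0`, `#Ш_an = Q`, `2^m ∣ #Ш`}. Closes nothing by itself.
[cite: Sprung2012, Thm. 7.14, 7.16 and Prop. 7.19] [cite: Sprung2024, §5.2 Lemmas 5.5–5.9]
[cite: Kato2004Asterisque, Thm. 12.4–12.5] [cite: KuriharaOtsuki2006, p. 564]
[cite: DokchitserDokchitserMathZ2012, Theorem] [cite: SilvermanAEC2009, VII.5 Prop. 5.1(a)] [cite: Miller2011LMS, Def. 1.1] -/
theorem bsdp_two_baseChange_int_of_flatColemanKato (M : WeierstrassCurve ℤ)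
    {B₂ B₄ B₆ D C4 n d : ℤ} (hb₂ : M.b₂ = B₂) (hb₄ : M.b₄ = B₄) (hb₆ : M.b₆ = B₆) (hΔ : M.Δ = D)
    (hc₄ : M.c₄ = C4) (h2 : ¬ (2 : ℤ) ∣ D)
    {k : ℕ} (hcard : Nat.card (M.map (Int.castRingHom (ZMod 2))).toAffine.Point = k) (hk : k = 1 ∨ k = 5)
    (hd : d ≠ 0) (hnd : (C4 : ℚ) ^ 3 / (D : ℚ) = (n : ℚ) / (d : ℚ))
    {ℓ₁ ℓ₂ ℓ₃ ℓ₄ : ℕ} (hℓ₄ : 1 < ℓ₄)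
    (h₁ : ∀ r : ZMod ℓ₁,
      r ^ 3 + (B₂ : ZMod ℓ₁) * r ^ 2 + ((8 * B₄ : ℤ) : ZMod ℓ₁) * r + ((16 * B₆ : ℤ) : ZMod ℓ₁) ≠ 0)
    (h₂ : ∀ r : ZMod ℓ₂, r * r ≠ ((|D| : ℤ) : ZMod ℓ₂))
    (h₃ : ∀ r : ZMod ℓ₃, r * r ≠ ((2 * |D| : ℤ) : ZMod ℓ₃))
    (h₄ : ∀ a b : ZMod ℓ₄, (a ≠ 0 ∨ b ≠ 0) →
      4 * (d : ZMod ℓ₄) * a ^ 4 + 32 * (d : ZMod ℓ₄) * a ^ 3 * b + (n : ZMod ℓ₄) * b ^ 4 ≠ 0)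
    {Q m : ℕ} (hQ : Q ≠ 0) (hQm : ¬ 2 ^ (m + 1) ∣ Q)
    (hmod : nonempty_modularParametrizationData)
    (hGZK : rank_eq_analyticRank_of_analyticRank_le_one)
    (h124 : Kato2004.thm12_4) (hX0 : Kato2004_fineSelmerDual_isTorsion)
    (hDD : DokchitserDokchitser2012_surjective_mod_two_four_eight) :
    ∀ (W : WeierstrassCurve ℚ) [W.IsElliptic] [W.IsGloballyMinimal], W = M.baseChange ℚ →
    ∀ (κ : ZpExtension ℚ 2) (γ : Field.absoluteGaloisGroup ℚ), κ.IsCyclotomic → κ.IsTopGenerator γ →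
    ∀ {E : Type} [Field E] [Algebra ℚ E] (ι : AlgebraicClosure ℚ →ₐ[ℚ] AlgebraicClosure E)
      (g : Field.absoluteGaloisGroup E) (c : ℕ → localPoints W E),
    (∀ (D : SharpFlatSelmerDualData W κ γ ι (W.frobeniusTrace 2) g c .flat)
        [Module.Finite (IwasawaAlgebra 2) D.X], Module.IsTorsion (IwasawaAlgebra 2) D.X →
      ∀ f : IwasawaAlgebra 2, D.charIdeal = Ideal.span {f} → Finite (W.selmerGroupPInfty 2) →
        ∃ u : ℤ_[2]ˣ, ((PowerSeries.constantCoeff f : ℤ_[2]) : ℚ_[2]) =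
          ((u : ℤ_[2]) : ℚ_[2]) * ((2 : ℕ) : ℚ_[2]) ^ (padicValNat 2 W.tamagawaProduct) *
            (Nat.card (W.selmerGroupPInfty 2) : ℚ_[2])) →
    (∀ [NeZero (W.conductorNorm ℤ)] (f : CuspForm (Gamma0 (W.conductorNorm ℤ)) 2),
        IsNewformOf W f → ∀ (ϖ : ℚ), (ϖ : ℝ) * W.realPeriodRat = plusPeriod f →
      ∀ (Ls Lf : IwasawaAlgebra 2), IsSprungPair f 2 (W.frobeniusTrace 2) Ls Lf →
      ∀ (D : SharpFlatSelmerDualData W κ γ ι (W.frobeniusTrace 2) g c .flat)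
        [ContinuousSMul ℤ_[2] (W.tateModule 2)],
        ∃ (I : Kato2004.IwasawaH1Data W 2 κ γ) (Y : W.FineSelmerDualData κ γ)
          (P : Submodule (IwasawaAlgebra 2) (IwasawaAlgebra 2))
          (loc : I.H →ₗ[IwasawaAlgebra 2] P) (toX : P →ₗ[IwasawaAlgebra 2] D.X)
          (δ : D.X →ₗ[IwasawaAlgebra 2] Y.X) (Z : Submodule (IwasawaAlgebra 2) I.H)
          (G : IwasawaAlgebra 2),
          Function.Exact loc toX ∧ Function.Exact toX δ ∧
          G ∈ Submodule.map (P.subtype ∘ₗ loc) Z ∧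
          iwasawaToPowerSeries 2 G = PowerSeries.C (ϖ : ℚ_[2]) * iwasawaToPowerSeries 2 Lf ∧
          (∀ 𝔭 : PrimeSpectrum (IwasawaAlgebra 2), 𝔭.asIdeal.height = 1 →
            PowerSeries.C (2 : ℤ_[2]) ∉ 𝔭.asIdeal →
            Literature.NumberTheory.EllipticCurves.Module.lengthAt (IwasawaAlgebra 2) Y.X 𝔭 ≤
              Literature.NumberTheory.EllipticCurves.Module.lengthAt (IwasawaAlgebra 2) (I.H ⧸ Z) 𝔭) ∧
          (TwoAdicSurjective W →
            ∀ 𝔭 : PrimeSpectrum (IwasawaAlgebra 2), 𝔭.asIdeal.height = 1 →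
              PowerSeries.C (2 : ℤ_[2]) ∈ 𝔭.asIdeal →
              Literature.NumberTheory.EllipticCurves.Module.lengthAt (IwasawaAlgebra 2) Y.X 𝔭 ≤
                Literature.NumberTheory.EllipticCurves.Module.lengthAt (IwasawaAlgebra 2) (I.H ⧸ Z) 𝔭)) →
    W.entireLFunction 1 ≠ 0 → shaAn W = ((Q : ℚ) : ℂ) → 2 ^ m ∣ W.shaOrder → BSDp W 2 := by
  intro W _ _ hW κ γ hκ hγ E _ _ ι g c hEC hCK hL hq hdvd
  subst hW
  obtain ⟨hgood, ha, hss⟩ := goodSS_two_baseChange_int_of_card M (by rwa [hΔ]) hcard hk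
  exact bsdp_two_of_flatColemanKato_of_pow_dvd _ ι g c hmod hGZK h124 hX0 hgood hss.2 hL hκ hγ
    (SSColemanRoad.twoAdicSurjective_baseChange_int_of_certificates M hDD hb₂ hb₄ hb₆ hΔ hc₄ hd hnd hℓ₄
      h₁ h₂ h₃ h₄)
    hEC hCK hq (SSColemanRoad.padicValRat_two_natCast_le hQ hQm) hdvd

/-- **`BSD(E, 2)` for `E = M ⊗ ℚ` FROM THE ♭ UPPER DIVISIBILITY AT THE CURVE** — the class-instance shape
on an `a₂ = ±2` class WITHOUT a `2`-adic image certificate: the READ-AT-2 binders are the ♭ `Γ`-Euler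
characteristic at `2` and the ♭ upper divisibility at `2` itself (`hup`: `X^♭` torsion, `char X^♭ = (g')`,
`ι(g'·h) = ϖ·ι L♭` over every Sprung pair at `2` — on such a curve the conclusion of
`SSFlatRoad.flatUpper_two_of_flatColemanKato_of_mu`, i.e. the package's rational part + `μ(X^♭) = 0`).
KERNEL inputs: `Δ(M) = D` odd, `#M̃(𝔽₂) ∈ {1, 5}`, `2^(m+1) ∤ Q`. Closes nothing by itself.
[cite: Sprung2012, Thm. 7.14, 7.16 and Main Conj. 7.21] [cite: Sprung2024, §5.2 Lemmas 5.5–5.9]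
[cite: SilvermanAEC2009, VII.5 Prop. 5.1(a)] [cite: Miller2011LMS, Def. 1.1] -/
theorem bsdp_two_baseChange_int_of_flatUpper (M : WeierstrassCurve ℤ) {D : ℤ} (hΔ : M.Δ = D)
    (h2 : ¬ (2 : ℤ) ∣ D)
    {k : ℕ} (hcard : Nat.card (M.map (Int.castRingHom (ZMod 2))).toAffine.Point = k) (hk : k = 1 ∨ k = 5)
    {Q m : ℕ} (hQ : Q ≠ 0) (hQm : ¬ 2 ^ (m + 1) ∣ Q)
    (hmod : nonempty_modularParametrizationData)
    (hGZK : rank_eq_analyticRank_of_analyticRank_le_one) :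
    ∀ (W : WeierstrassCurve ℚ) [W.IsElliptic] [W.IsGloballyMinimal], W = M.baseChange ℚ →
    ∀ (κ : ZpExtension ℚ 2) (γ : Field.absoluteGaloisGroup ℚ), κ.IsCyclotomic → κ.IsTopGenerator γ →
    ∀ {E : Type} [Field E] [Algebra ℚ E] (ι : AlgebraicClosure ℚ →ₐ[ℚ] AlgebraicClosure E)
      (g : Field.absoluteGaloisGroup E) (c : ℕ → localPoints W E),
    (∀ (D : SharpFlatSelmerDualData W κ γ ι (W.frobeniusTrace 2) g c .flat)
        [Module.Finite (IwasawaAlgebra 2) D.X], Module.IsTorsion (IwasawaAlgebra 2) D.X →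
      ∀ f : IwasawaAlgebra 2, D.charIdeal = Ideal.span {f} → Finite (W.selmerGroupPInfty 2) →
        ∃ u : ℤ_[2]ˣ, ((PowerSeries.constantCoeff f : ℤ_[2]) : ℚ_[2]) =
          ((u : ℤ_[2]) : ℚ_[2]) * ((2 : ℕ) : ℚ_[2]) ^ (padicValNat 2 W.tamagawaProduct) *
            (Nat.card (W.selmerGroupPInfty 2) : ℚ_[2])) →
    (∀ [NeZero (W.conductorNorm ℤ)] (f : CuspForm (Gamma0 (W.conductorNorm ℤ)) 2),
        IsNewformOf W f → ∀ (ϖ : ℚ), (ϖ : ℝ) * W.realPeriodRat = plusPeriod f →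
      ∀ (Ls Lf : IwasawaAlgebra 2), IsSprungPair f 2 (W.frobeniusTrace 2) Ls Lf →
      ∀ (D : SharpFlatSelmerDualData W κ γ ι (W.frobeniusTrace 2) g c .flat),
        Module.IsTorsion (IwasawaAlgebra 2) D.X ∧
        ∃ g' h : IwasawaAlgebra 2, D.charIdeal = Ideal.span {g'} ∧
          iwasawaToPowerSeries 2 (g' * h) = PowerSeries.C (ϖ : ℚ_[2]) * iwasawaToPowerSeries 2 Lf) →
    W.entireLFunction 1 ≠ 0 → shaAn W = ((Q : ℚ) : ℂ) → 2 ^ m ∣ W.shaOrder → BSDp W 2 := by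
  intro W _ _ hW κ γ _hκ hγ E _ _ ι g c hEC hup hL hq hdvd
  subst hW
  obtain ⟨hgood, ha, hss⟩ := goodSS_two_baseChange_int_of_card M (by rwa [hΔ]) hcard hk
  exact bsdp_two_of_flatUpper_of_pow_dvd _ ι g c hmod hGZK hgood hss.2 hL hγ hEC hup hq
    (SSColemanRoad.padicValRat_two_natCast_le hQ hQm) hdvd

end SSFlatRoad
end Summit.BirchSwinnertonDyer.BirchSwinnertonDyer.Theorems

end
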